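import Literature.NumberTheory.Automorphic.QuaternionDefiniteNorm
import Literature.NumberTheory.Automorphic.QuaternionInvolutionToolkit
import Literature.NumberTheory.Automorphic.BrandtModule
import Literature.NumberTheory.Automorphic.BrandtIndexReducedNorm
import Mathlib.Analysis.InnerProductSpace.PiL2
import Mathlib.Algebra.Module.ZLattice.Covolume
import Mathlib.MeasureTheory.Measure.Haar.InnerProductSpace
import HarnessLib

/-!
# The Euclidean model of a definite quaternion algebra: `B ↪ ℝ⁴` with `nrd = ‖·‖²`, and the
# covolume of its lattices

Topic `NumberTheory/Automorphic`; two small definitions (`latticeMap`, the image of a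
`ℤ`-lattice of `B` in `ℝ⁴`, and `covol`, its covolume), otherwise theorems; no named fact, no
instance. For a totally definite quaternion algebra `B` over `ℚ` — `B ≅ ℍ[ℚ,a,b]` with
`a, b < 0` (`exists_algEquiv_quaternionAlgebra_of_isTotallyDefinite`) and
`nrd = x₀² + (-a)x₁² + (-b)x₂² + ab x₃²` (`reducedNorm_eq_sum_sq`) — the `ℚ`-linear map

  `ψ(x) = (x₀, √(-a) x₁, √(-b) x₂, √(ab) x₃) ∈ ℝ⁴`

satisfies **`‖ψ(x)‖² = nrd(x)`** and spans `ℝ⁴` (`exists_euclideanEmbedding`); consequently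
`⟪ψ x, ψ y⟫ = trd(x ȳ)/2` and `ψ` is injective. The image `ψ(L)` of a full `ℤ`-lattice
`L ⊆ B` is a `ℤ`-lattice of `ℝ⁴` (Mathlib `IsZLattice`), spanned over `ℤ` by the `ℝ`-basis
`ψ(b₁), …, ψ(b₄)` for any `ℤ`-basis `bᵢ` of `L` (`latticeMap_eq_span`), and its covolume is

  `covol ψ L = |det (ψ(bᵢ)ⱼ)|`   (`covol_eq_abs_det`),

computed by transport to `Fin 4 → ℝ` (Mathlib `ZLattice.covolume_comap`, `covolume_eq_det`).
Further: `covol ψ L' = [L : L'] covol ψ L` for `L' ≤ L` (Mathlib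
`ZLattice.covolume_div_covolume_eq_relIndex'`), `covol ψ (β L) = nrd(β)² covol ψ L`
(the determinant of left multiplication by `β` is `N_{B/ℚ}(β) = nrd(β)²`), and
`16 covol(ψ L)² = det (trd(bᵢ b̄ⱼ))` (Gram determinant). This is the geometric normalisation
of the lattice-point count in Eichler's mass formula (`brandtModule_massFormula`; Vignéras V §2
uses the Tamagawa measure instead; Eichler/Hey and Voight §25.4, §26.2 count lattice points).

## References

* M.-F. Vignéras, *Arithmétique des algèbres de quaternions*, LNM 800 (1980), Ch. I §1,
  Ch. III §3, Ch. V §2 [VignerasLNM800].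
* J. Voight, *Quaternion Algebras*, GTM 288 (2021), §17.7 (lattices and covolumes), §25.4.
-/

noncomputable section

open scoped Pointwise InnerProductSpace RealInnerProductSpace
open MeasureTheory Module Quaternion

universe u

namespace Literature.NumberTheory.Automorphic

variable {B : Type u} [Ring B] [Algebra ℚ B] [IsQuaternionAlgebra ℚ B]

/-! ### The embedding -/

section Embedding

/-- **The Euclidean model**: for a totally definite quaternion algebra `B` over `ℚ` there is a
`ℚ`-linear map `ψ : B → ℝ⁴` with `‖ψ x‖² = nrd x` whose image spans `ℝ⁴`
(`ψ = (x₀, √(-a) x₁, √(-b) x₂, √(ab) x₃)` on `B ≅ ℍ[ℚ,a,b]`, `a, b < 0`). [cite: VignerasLNM800, Ch. I §1 p. 3 and Ch. III §3] -/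
theorem exists_euclideanEmbedding (hdef : IsTotallyDefinite ℚ B) :
    ∃ ψ : B →ₗ[ℚ] EuclideanSpace ℝ (Fin 4),
      (∀ x, ‖ψ x‖ ^ 2 = ((reducedNorm ℚ B x : ℚ) : ℝ)) ∧ Submodule.span ℝ (Set.range ψ) = ⊤ := by
  classical
  obtain ⟨a, b, ha, hb, ⟨e⟩⟩ := exists_algEquiv_quaternionAlgebra_of_isTotallyDefinite B hdef
  -- the scaling factors
  let s : Fin 4 → ℝ := ![1, Real.sqrt (-a), Real.sqrt (-b), Real.sqrt (a * b)]
  have ha' : (0 : ℝ) < -(a : ℝ) := by exact_mod_cast neg_pos.mpr ha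
  have hb' : (0 : ℝ) < -(b : ℝ) := by exact_mod_cast neg_pos.mpr hb
  have hab' : (0 : ℝ) < (a : ℝ) * b := by exact_mod_cast mul_pos_of_neg_of_neg ha hb
  have hs : ∀ i, s i ≠ 0 := by
    intro i
    fin_cases i
    · show (1 : ℝ) ≠ 0; exact one_ne_zero
    · show Real.sqrt (-(a : ℝ)) ≠ 0; exact Real.sqrt_ne_zero'.mpr ha'
    · show Real.sqrt (-(b : ℝ)) ≠ 0; exact Real.sqrt_ne_zero'.mpr hb'
    · show Real.sqrt ((a : ℝ) * b) ≠ 0; exact Real.sqrt_ne_zero'.mpr hab'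
  have hs2 : ∀ i, s i ^ 2 = ![(1 : ℝ), -a, -b, a * b] i := by
    intro i
    fin_cases i
    · show (1 : ℝ) ^ 2 = 1; norm_num
    · show Real.sqrt (-(a : ℝ)) ^ 2 = -(a : ℝ); exact Real.sq_sqrt ha'.le
    · show Real.sqrt (-(b : ℝ)) ^ 2 = -(b : ℝ); exact Real.sq_sqrt hb'.le
    · show Real.sqrt ((a : ℝ) * b) ^ 2 = (a : ℝ) * b; exact Real.sq_sqrt hab'.le
  -- coordinates
  let κ : ℍ[ℚ,a,b] →ₗ[ℚ] (Fin 4 → ℚ) := (QuaternionAlgebra.linearEquivTuple a 0 b).toLinearMap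
  have hκ : ∀ q : ℍ[ℚ,a,b], κ q = ![q.re, q.imI, q.imJ, q.imK] := fun q => rfl
  -- the map to `Fin 4 → ℝ`
  let ψ₀ : B →ₗ[ℚ] (Fin 4 → ℝ) :=
    { toFun := fun x i => s i * ((κ (e x) i : ℚ) : ℝ)
      map_add' := fun x y => by
        ext i
        simp only [map_add, Pi.add_apply, Rat.cast_add]
        ring
      map_smul' := fun c x => by
        ext i
        simp only [map_smul, Pi.smul_apply, smul_eq_mul, Rat.cast_mul, RingHom.id_apply, Rat.smul_def]
        ring }
  have hψ₀ : ∀ x i, ψ₀ x i = s i * ((κ (e x) i : ℚ) : ℝ) := fun x i => rfl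
  let ψ : B →ₗ[ℚ] EuclideanSpace ℝ (Fin 4) :=
    ((EuclideanSpace.equiv (Fin 4) ℝ).symm.toLinearEquiv.toLinearMap.restrictScalars ℚ).comp ψ₀
  have hψ : ∀ x i, ψ x i = s i * ((κ (e x) i : ℚ) : ℝ) := fun x i => rfl
  refine ⟨ψ, fun x => ?_, ?_⟩
  · -- `‖ψ x‖² = nrd x`
    rw [EuclideanSpace.norm_sq_eq]
    simp only [Real.norm_eq_abs, sq_abs, hψ, mul_pow, hs2]
    rw [Fin.sum_univ_four]
    simp only [Matrix.cons_val_zero, Matrix.cons_val_one, Matrix.cons_val, hκ]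
    rw [← reducedNorm_algEquiv e x, QuaternionAlgebra.reducedNorm_eq_sum_sq]
    push_cast
    ring
  · -- the image spans
    refine Submodule.eq_top_iff'.mpr fun v => ?_
    have hbasis : ∀ i : Fin 4, EuclideanSpace.single i (1 : ℝ) ∈ Submodule.span ℝ (Set.range ψ) := by
      intro i
      -- the quaternion with a single coordinate `1`
      let q : ℍ[ℚ,a,b] := (QuaternionAlgebra.linearEquivTuple a 0 b).symm (Pi.single i 1)
      have hq : κ q = Pi.single i 1 := (QuaternionAlgebra.linearEquivTuple a 0 b).apply_symm_apply _
      have hψq : ψ (e.symm q) = (s i) • EuclideanSpace.single i (1 : ℝ) := by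
        ext j
        rw [hψ, e.apply_symm_apply, hq, PiLp.smul_apply, PiLp.single_apply, smul_eq_mul]
        by_cases hij : j = i
        · subst hij; simp
        · rw [Pi.single_eq_of_ne hij]; simp [hij]
      have hmem : ψ (e.symm q) ∈ Submodule.span ℝ (Set.range ψ) := Submodule.subset_span ⟨_, rfl⟩
      rw [hψq] at hmem
      have := Submodule.smul_mem _ (s i)⁻¹ hmem
      rwa [smul_smul, inv_mul_cancel₀ (hs i), one_smul] at this
    have hv : v = ∑ i, v i • EuclideanSpace.single i (1 : ℝ) := by
      ext j
      simp only [WithLp.ofLp_sum, Finset.sum_apply, WithLp.ofLp_smul, Pi.smul_apply, PiLp.single_apply,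
        smul_eq_mul, mul_ite, mul_one, mul_zero]
      rw [Finset.sum_ite_eq Finset.univ j, if_pos (Finset.mem_univ _)]
    rw [hv]
    exact Submodule.sum_mem _ fun i _ => Submodule.smul_mem _ _ (hbasis i)

variable (ψ : B →ₗ[ℚ] EuclideanSpace ℝ (Fin 4))
  (hψn : ∀ x, ‖ψ x‖ ^ 2 = ((reducedNorm ℚ B x : ℚ) : ℝ))
include hψn

/-- **`⟪ψ x, ψ y⟫ = trd(x ȳ) / 2`** (polarisation of `‖ψ x‖² = nrd x`:
`nrd(x + y) = nrd x + nrd y + trd(x ȳ)`). [cite: VignerasLNM800, Ch. I §1 Lemme 1.1] -/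
theorem inner_euclideanEmbedding (x y : B) :
    ⟪ψ x, ψ y⟫ = ((reducedTrace ℚ B (x * standardInvolution ℚ B y) : ℚ) : ℝ) / 2 := by
  have h := norm_add_sq_real (ψ x) (ψ y)
  rw [← map_add, hψn, hψn, hψn, reducedNorm_add ℚ x y] at h
  push_cast at h
  linarith

/-- In a totally definite quaternion algebra the Euclidean model is injective. [folklore] -/
theorem injective_euclideanEmbedding (hdef : IsTotallyDefinite ℚ B) : Function.Injective ψ := by
  intro x y hxy
  by_contra hne
  have hpos := reducedNorm_pos_of_isTotallyDefinite B hdef (sub_ne_zero.mpr hne)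
  have h := hψn (x - y)
  rw [map_sub, hxy, sub_self, norm_zero] at h
  have : ((reducedNorm ℚ B (x - y) : ℚ) : ℝ) = 0 := by rw [← h]; norm_num
  exact hpos.ne' (by exact_mod_cast this)

end Embedding

/-! ### `ℤ`-bases of full lattices -/

section Bases

omit [IsQuaternionAlgebra ℚ B] in
/-- A full `ℤ`-lattice of a quaternion algebra over `ℚ` is free of rank `4`. [folklore] -/
theorem IsFullLattice.nonempty_basis_fin_four [IsQuaternionAlgebra ℚ B] {L : Submodule ℤ B}
    (hL : IsFullLattice B L) : Nonempty (Module.Basis (Fin 4) ℤ L) := by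
  haveI : IsAddTorsionFree B := isAddTorsionFree_of_charZero_module ℚ B
  haveI : Module.Finite ℤ L := Module.Finite.iff_fg.mpr hL.1
  haveI : IsAddTorsionFree L := L.toAddSubgroup.instIsAddTorsionFree
  haveI := isLocalizedModule_subtype_of_isFullLattice hL
  let b := Module.Free.chooseBasis ℤ L
  let bQ : Module.Basis _ ℚ B := b.ofIsLocalizedModule ℚ (nonZeroDivisors ℤ) L.subtype
  have hcard : Fintype.card (Module.Free.ChooseBasisIndex ℤ L) = 4 := by
    rw [← Module.finrank_eq_card_basis bQ, IsQuaternionAlgebra.finrank_eq_four (K := ℚ) (D := B)]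
  exact ⟨b.reindex (Fintype.equivOfCardEq (by rw [hcard, Fintype.card_fin]))⟩

omit [Algebra ℚ B] [IsQuaternionAlgebra ℚ B] in
/-- A full lattice is the `ℤ`-span of any of its `ℤ`-bases (inside `B`). [folklore] -/
theorem eq_span_range_basis {L : Submodule ℤ B} {ι : Type*} (bL : Module.Basis ι ℤ L) :
    L = Submodule.span ℤ (Set.range fun i => (bL i : B)) := by
  have h := congrArg (Submodule.map L.subtype) bL.span_eq
  rw [Submodule.map_span, Submodule.map_top, Submodule.range_subtype, ← Set.range_comp] at h
  exact h.symm

end Bases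

/-! ### Images of lattices in `ℝ⁴` and their covolume -/

section Lattices

variable (ψ : B →ₗ[ℚ] EuclideanSpace ℝ (Fin 4))

/-- The image `ψ(L) ⊆ ℝ⁴` of a `ℤ`-lattice `L ⊆ B` under the Euclidean model. [folklore] -/
def latticeMap (L : Submodule ℤ B) : Submodule ℤ (EuclideanSpace ℝ (Fin 4)) := L.map (ψ.restrictScalars ℤ)

omit [IsQuaternionAlgebra ℚ B] in
/-- Membership in `latticeMap` (definitional). [folklore] -/
theorem mem_latticeMap_iff {L : Submodule ℤ B} {v : EuclideanSpace ℝ (Fin 4)} :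
    v ∈ latticeMap ψ L ↔ ∃ x ∈ L, ψ x = v := by
  simp [latticeMap, Submodule.mem_map]

omit [IsQuaternionAlgebra ℚ B] in
/-- `latticeMap` is monotone. [folklore] -/
theorem latticeMap_mono {L L' : Submodule ℤ B} (h : L ≤ L') : latticeMap ψ L ≤ latticeMap ψ L' :=
  Submodule.map_mono h

omit [IsQuaternionAlgebra ℚ B] in
/-- `ψ(L)` is the `ℤ`-span of `ψ` of a `ℤ`-basis of `L`. [folklore] -/
theorem latticeMap_eq_span {L : Submodule ℤ B} {ι : Type*} (bL : Module.Basis ι ℤ L) :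
    latticeMap ψ L = Submodule.span ℤ (Set.range fun i => ψ (bL i : B)) := by
  conv_lhs => rw [latticeMap, eq_span_range_basis bL]
  rw [Submodule.map_span, ← Set.range_comp]
  rfl

variable (hψs : Submodule.span ℝ (Set.range ψ) = ⊤)
include hψs

omit [IsQuaternionAlgebra ℚ B] in
/-- The images under `ψ` of a `ℤ`-basis of a full lattice span `ℝ⁴` over `ℝ`. [folklore] -/
theorem span_range_basis_eq_top {L : Submodule ℤ B} (hL : IsFullLattice B L) {ι : Type*}
    (bL : Module.Basis ι ℤ L) : Submodule.span ℝ (Set.range fun i => ψ (bL i : B)) = ⊤ := by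
  refine eq_top_iff.mpr (hψs.symm.le.trans (Submodule.span_le.mpr ?_))
  rintro _ ⟨x, rfl⟩
  obtain ⟨n, hn, hnx⟩ := hL.2 x
  have hrepr : ψ (n • x) = ∑ i ∈ (bL.repr ⟨n • x, hnx⟩).support, ((bL.repr ⟨n • x, hnx⟩ i : ℤ) : ℝ) • ψ (bL i : B) := by
    have h := congrArg (fun y : L => ψ (y : B)) (bL.linearCombination_repr ⟨n • x, hnx⟩).symm
    simp only [Finsupp.linearCombination_apply, Finsupp.sum] at h
    rw [h, Submodule.coe_sum, map_sum]
    refine Finset.sum_congr rfl fun i _ => ?_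
    rw [Submodule.coe_smul, LinearMap.map_smul_of_tower, Int.cast_smul_eq_zsmul]
  have hnR : (n : ℝ) ≠ 0 := by exact_mod_cast hn
  have hx : ψ x = (n : ℝ)⁻¹ • ψ (n • x) := by
    rw [LinearMap.map_smul_of_tower, ← Int.cast_smul_eq_zsmul ℝ n, smul_smul, inv_mul_cancel₀ hnR, one_smul]
  rw [hx, hrepr]
  exact Submodule.smul_mem _ _ (Submodule.sum_mem _ fun i _ =>
    Submodule.smul_mem _ _ (Submodule.subset_span ⟨i, rfl⟩))

omit [IsQuaternionAlgebra ℚ B] in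
/-- The images under `ψ` of a `ℤ`-basis (indexed by `Fin 4`) of a full lattice are
`ℝ`-linearly independent. [folklore] -/
theorem linearIndependent_basis {L : Submodule ℤ B} (hL : IsFullLattice B L) (bL : Module.Basis (Fin 4) ℤ L) :
    LinearIndependent ℝ (fun i => ψ (bL i : B)) :=
  linearIndependent_of_top_le_span_of_card_eq_finrank (span_range_basis_eq_top ψ hψs hL bL).symm.le
    (by rw [Fintype.card_fin, finrank_euclideanSpace_fin])

omit [IsQuaternionAlgebra ℚ B] in
/-- **`ψ(L)` is a `ℤ`-lattice of `ℝ⁴`**: it is the `ℤ`-span of an `ℝ`-basis of `ℝ⁴`. [folklore] -/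
theorem exists_basis_latticeMap_eq_span {L : Submodule ℤ B} (hL : IsFullLattice B L) (bL : Module.Basis (Fin 4) ℤ L) :
    ∃ b : Module.Basis (Fin 4) ℝ (EuclideanSpace ℝ (Fin 4)), (∀ i, b i = ψ (bL i : B)) ∧
      latticeMap ψ L = Submodule.span ℤ (Set.range b) := by
  refine ⟨Module.Basis.mk (linearIndependent_basis ψ hψs hL bL) (span_range_basis_eq_top ψ hψs hL bL).symm.le,
    fun i => Module.Basis.mk_apply _ _ i, ?_⟩
  rw [latticeMap_eq_span ψ bL, Module.Basis.coe_mk]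

end Lattices

/-! ### Covolume -/

section Covolume

omit [IsQuaternionAlgebra ℚ B] in
/-- The covolume only depends on the lattice (proof-irrelevance of the instance arguments). [folklore] -/
theorem ZLattice.covolume_congr {L₁ L₂ : Submodule ℤ (EuclideanSpace ℝ (Fin 4))} [DiscreteTopology L₁]
    [IsZLattice ℝ L₁] [DiscreteTopology L₂] [IsZLattice ℝ L₂] (h : L₁ = L₂) :
    ZLattice.covolume L₁ = ZLattice.covolume L₂ := by
  subst h; rfl

omit [IsQuaternionAlgebra ℚ B] in
/-- **Covolume of the `ℤ`-span of an `ℝ`-basis of `ℝ⁴`** = absolute determinant of the coordinate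
matrix (transport to `Fin 4 → ℝ` along the volume-preserving `WithLp` equivalence, Mathlib
`ZLattice.covolume_comap`, `ZLattice.covolume_eq_det`). [folklore] -/
theorem covolume_span_eq_abs_det (b : Module.Basis (Fin 4) ℝ (EuclideanSpace ℝ (Fin 4))) :
    ZLattice.covolume (Submodule.span ℤ (Set.range b)) = |(Matrix.of fun i j => b i j).det| := by
  classical
  set L : Submodule ℤ (EuclideanSpace ℝ (Fin 4)) := Submodule.span ℤ (Set.range b) with hL
  let e : (Fin 4 → ℝ) ≃L[ℝ] EuclideanSpace ℝ (Fin 4) := (EuclideanSpace.equiv (Fin 4) ℝ).symm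
  have he : MeasurePreserving e volume volume := PiLp.volume_preserving_toLp (Fin 4)
  rw [← ZLattice.covolume_comap L volume volume he]
  let bZ : Module.Basis (Fin 4) ℤ L := b.restrictScalars ℤ
  rw [ZLattice.covolume_eq_det _ (bZ.ofZLatticeComap ℝ L e.toLinearEquiv)]
  congr 2
  ext i j
  rw [Matrix.of_apply, Function.comp_apply, Module.Basis.ofZLatticeComap_apply, Matrix.of_apply]
  change (EuclideanSpace.equiv (Fin 4) ℝ) ((bZ i : EuclideanSpace ℝ (Fin 4))) j = b i j
  rw [Module.Basis.restrictScalars_apply]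
  rfl

variable (ψ : B →ₗ[ℚ] EuclideanSpace ℝ (Fin 4))

omit [IsQuaternionAlgebra ℚ B] in
/-- Transport of the lattice instances along an equality of submodules. [folklore] -/
theorem ZLattice.exists_instances_of_eq {L₁ L₂ : Submodule ℤ (EuclideanSpace ℝ (Fin 4))} (h : L₁ = L₂)
    [i : DiscreteTopology L₂] [j : IsZLattice ℝ L₂] : ∃ _ : DiscreteTopology L₁, IsZLattice ℝ L₁ := by
  subst h; exact ⟨i, j⟩

open Classical in
/-- **The covolume of `ψ(L)`** (`0` by convention if `ψ(L)` is not a `ℤ`-lattice of `ℝ⁴`). [folklore] -/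
def covol (L : Submodule ℤ B) : ℝ :=
  if h : ∃ _ : DiscreteTopology (latticeMap ψ L), IsZLattice ℝ (latticeMap ψ L) then
    (by haveI := h.fst; haveI := h.snd; exact ZLattice.covolume (latticeMap ψ L))
  else 0

omit [IsQuaternionAlgebra ℚ B] in
/-- `covol ψ L` is the covolume of `span ℤ (range b)` whenever `ψ(L) = span ℤ (range b)` for an
`ℝ`-basis `b`. [folklore] -/
theorem covol_eq_covolume_span {L : Submodule ℤ B} (b : Module.Basis (Fin 4) ℝ (EuclideanSpace ℝ (Fin 4)))
    (hb : latticeMap ψ L = Submodule.span ℤ (Set.range b)) :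
    covol ψ L = ZLattice.covolume (Submodule.span ℤ (Set.range b)) := by
  obtain ⟨i1, i2⟩ := ZLattice.exists_instances_of_eq hb
  rw [covol, dif_pos ⟨i1, i2⟩]
  exact ZLattice.covolume_congr hb

variable (hψs : Submodule.span ℝ (Set.range ψ) = ⊤)
include hψs

omit [IsQuaternionAlgebra ℚ B] in
/-- **`covol ψ L = |det (ψ(bᵢ)ⱼ)|`** for any `ℤ`-basis `(bᵢ)` of the full lattice `L`. [folklore] -/
theorem covol_eq_abs_det {L : Submodule ℤ B} (hL : IsFullLattice B L) (bL : Module.Basis (Fin 4) ℤ L) :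
    covol ψ L = |(Matrix.of fun i j => ψ (bL i : B) j).det| := by
  obtain ⟨b, hb, hspan⟩ := exists_basis_latticeMap_eq_span ψ hψs hL bL
  rw [covol_eq_covolume_span ψ b hspan, covolume_span_eq_abs_det]
  congr 3
  ext i j
  rw [hb]

/-- The covolume of a full lattice is positive. [folklore] -/
theorem covol_pos {L : Submodule ℤ B} (hL : IsFullLattice B L) : 0 < covol ψ L := by
  obtain ⟨bL⟩ := hL.nonempty_basis_fin_four
  obtain ⟨b, -, hspan⟩ := exists_basis_latticeMap_eq_span ψ hψs hL bL
  rw [covol_eq_covolume_span ψ b hspan]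
  exact ZLattice.covolume_pos _ _

/-- **Covolumes and indices**: `covol ψ L' = [L : L'] covol ψ L` for full lattices `L' ≤ L`
(Mathlib `ZLattice.covolume_div_covolume_eq_relIndex'`; `ψ` injective). [folklore] -/
theorem covol_eq_relIndex_mul (hψi : Function.Injective ψ) {L L' : Submodule ℤ B} (hL : IsFullLattice B L)
    (hL' : IsFullLattice B L') (hle : L' ≤ L) :
    covol ψ L' = L'.toAddSubgroup.relIndex L.toAddSubgroup * covol ψ L := by
  obtain ⟨bL⟩ := hL.nonempty_basis_fin_four
  obtain ⟨bL'⟩ := hL'.nonempty_basis_fin_four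
  obtain ⟨b, -, hb⟩ := exists_basis_latticeMap_eq_span ψ hψs hL bL
  obtain ⟨b', -, hb'⟩ := exists_basis_latticeMap_eq_span ψ hψs hL' bL'
  rw [covol_eq_covolume_span ψ b hb, covol_eq_covolume_span ψ b' hb']
  have hle' : Submodule.span ℤ (Set.range b') ≤ Submodule.span ℤ (Set.range b) := by
    rw [← hb, ← hb']; exact latticeMap_mono ψ hle
  have h := ZLattice.covolume_div_covolume_eq_relIndex' (Submodule.span ℤ (Set.range b'))
    (Submodule.span ℤ (Set.range b)) hle'
  have hidx : (Submodule.span ℤ (Set.range b')).toAddSubgroup.relIndex (Submodule.span ℤ (Set.range b)).toAddSubgroup =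
      L'.toAddSubgroup.relIndex L.toAddSubgroup := by
    rw [← hb, ← hb', latticeMap, latticeMap, Submodule.map_toAddSubgroup, Submodule.map_toAddSubgroup]
    exact AddSubgroup.relIndex_map_map_of_injective _ _ hψi
  rw [hidx] at h
  have hpos := ZLattice.covolume_pos (Submodule.span ℤ (Set.range b)) volume
  field_simp at h
  linarith [h]

end Covolume


/-! ### Covolume of translates and the Gram determinant -/

section Translates

variable (ψ : B →ₗ[ℚ] EuclideanSpace ℝ (Fin 4)) (hψs : Submodule.span ℝ (Set.range ψ) = ⊤)
include hψs

/-- **`covol ψ (β L) = nrd(β)² covol ψ L`** for a unit `β` of `B`: the matrix of `ψ(β bᵢ)` is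
`A · (ψ(bᵢ)ⱼ)` with `A` the (rational) matrix of left multiplication by `β` in the basis `bᵢ`,
and `det A = N_{B/ℚ}(β) = nrd(β)²`. [cite: VignerasLNM800, Ch. I §1 (N = n²)] -/
theorem covol_units_smul {L : Submodule ℤ B} (hL : IsFullLattice B L) (β : Bˣ) :
    covol ψ (β • L) = ((reducedNorm ℚ B (β : B) : ℚ) : ℝ) ^ 2 * covol ψ L := by
  classical
  haveI : IsAddTorsionFree B := isAddTorsionFree_of_charZero_module ℚ B
  haveI : Module.Finite ℤ L := Module.Finite.iff_fg.mpr hL.1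
  haveI : IsAddTorsionFree L := L.toAddSubgroup.instIsAddTorsionFree
  haveI := isLocalizedModule_subtype_of_isFullLattice hL
  obtain ⟨bL⟩ := hL.nonempty_basis_fin_four
  -- the translate and its basis
  let f : B →ₗ[ℤ] B := DistribSMul.toLinearMap ℤ B β
  have hf : ∀ x, f x = (β : B) * x := fun x => rfl
  have hfinj : Function.Injective f := fun x y hxy => by
    simpa [hf] using congrArg (fun w => ((β⁻¹ : Bˣ) : B) * w) hxy
  have hsmul : β • L = L.map f := rfl
  let eqv : L ≃ₗ[ℤ] (L.map f) := Submodule.equivMapOfInjective f hfinj L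
  let bβ : Module.Basis (Fin 4) ℤ ↥(β • L) := bL.map eqv
  have hbβ : ∀ i, ((bβ i : ↥(β • L)) : B) = (β : B) * bL i := fun i => by
    change ((eqv (bL i) : L.map f) : B) = _
    rw [Submodule.coe_equivMapOfInjective_apply]; rfl
  -- rational coordinates: `β bᵢ = ∑ₖ A i k • bₖ`
  let bQ : Module.Basis (Fin 4) ℚ B := bL.ofIsLocalizedModule ℚ (nonZeroDivisors ℤ) L.subtype
  have hbQ : ∀ k, bQ k = (bL k : B) := fun k => Module.Basis.ofIsLocalizedModule_apply _ _ _ _ k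
  let A : Matrix (Fin 4) (Fin 4) ℚ := Matrix.of fun i k => bQ.repr ((β : B) * bL i) k
  have hexp : ∀ i, (β : B) * bL i = ∑ k, A i k • (bL k : B) := by
    intro i
    conv_lhs => rw [← bQ.sum_repr ((β : B) * bL i)]
    exact Finset.sum_congr rfl fun k _ => by rw [hbQ]; rfl
  -- `det A = N(β) = nrd(β)²`
  have hdetA : A.det = reducedNorm ℚ B (β : B) ^ 2 := by
    have hT : A = (LinearMap.toMatrix bQ bQ (Algebra.lmul ℚ B (β : B))).transpose := by
      ext i k
      rw [Matrix.transpose_apply, LinearMap.toMatrix_apply]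
      change bQ.repr ((β : B) * bL i) k = bQ.repr ((Algebra.lmul ℚ B (β : B)) (bQ i)) k
      rw [hbQ]; rfl
    rw [hT, Matrix.det_transpose, LinearMap.det_toMatrix, ← Algebra.norm_apply, ← reducedNorm_sq_eq_norm_holds ℚ B]
  -- the two coordinate matrices
  set M₀ : Matrix (Fin 4) (Fin 4) ℝ := Matrix.of fun i j => ψ (bL i : B) j with hM₀
  have hMβ : (Matrix.of fun i j => ψ (bβ i : B) j) = (A.map ((↑) : ℚ → ℝ)) * M₀ := by
    ext i j
    rw [Matrix.of_apply, hbβ, hexp, map_sum, Matrix.mul_apply]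
    simp only [Matrix.map_apply, hM₀, Matrix.of_apply]
    rw [WithLp.ofLp_sum, Finset.sum_apply]
    refine Finset.sum_congr rfl fun k _ => ?_
    rw [LinearMap.map_smul_of_tower, ← Rat.cast_smul_eq_qsmul ℝ (A i k), WithLp.ofLp_smul, Pi.smul_apply, smul_eq_mul]
  rw [covol_eq_abs_det ψ hψs (hL.units_smul β) bβ, covol_eq_abs_det ψ hψs hL bL, hMβ, Matrix.det_mul,
    abs_mul, ← hM₀]
  congr 1
  have : (A.map ((↑) : ℚ → ℝ)).det = ((A.det : ℚ) : ℝ) := by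
    rw [show (A.map ((↑) : ℚ → ℝ)) = (Rat.castHom ℝ).mapMatrix A from rfl, ← RingHom.map_det]; rfl
  rw [this, hdetA]
  push_cast
  exact abs_of_nonneg (sq_nonneg _)

variable (hψn : ∀ x, ‖ψ x‖ ^ 2 = ((reducedNorm ℚ B x : ℚ) : ℝ))
include hψn

/-- **`16 covol(ψ L)² = det (trd(bᵢ b̄ⱼ))`** — the Gram determinant of the trace form
`(x, y) ↦ trd(x ȳ) = 2 ⟪ψ x, ψ y⟫` on a `ℤ`-basis of `L` (`covol = |det M|`,
`M Mᵀ = (⟪ψ bᵢ, ψ bⱼ⟫) = ½ (trd(bᵢ b̄ⱼ))`). [cite: VignerasLNM800, Ch. I §4 (discriminant réduit) and Ch. III §5] -/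
theorem sixteen_mul_covol_sq {L : Submodule ℤ B} (hL : IsFullLattice B L) (bL : Module.Basis (Fin 4) ℤ L) :
    16 * covol ψ L ^ 2 =
      (((Matrix.of fun i j => reducedTrace ℚ B ((bL i : B) * standardInvolution ℚ B (bL j : B))).det : ℚ) : ℝ) := by
  classical
  set M₀ : Matrix (Fin 4) (Fin 4) ℝ := Matrix.of fun i j => ψ (bL i : B) j with hM₀
  set G : Matrix (Fin 4) (Fin 4) ℚ := Matrix.of fun i j => reducedTrace ℚ B ((bL i : B) * standardInvolution ℚ B (bL j : B))
    with hG
  have hgram : M₀ * M₀.transpose = ((1 / 2 : ℝ)) • G.map ((↑) : ℚ → ℝ) := by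
    ext i j
    rw [Matrix.mul_apply, Matrix.smul_apply, Matrix.map_apply, smul_eq_mul]
    simp only [Matrix.transpose_apply, hM₀, Matrix.of_apply]
    have h := inner_euclideanEmbedding ψ hψn (bL i : B) (bL j : B)
    rw [EuclideanSpace.inner_eq_star_dotProduct, dotProduct] at h
    simp only [star_trivial] at h
    rw [show (∑ k, (ψ (bL i : B)) k * (ψ (bL j : B)) k) = ∑ k, (ψ (bL j : B)) k * (ψ (bL i : B)) k from
      Finset.sum_congr rfl fun k _ => mul_comm _ _, h, hG, Matrix.of_apply]
    ring
  have hdet : M₀.det ^ 2 = (1 / 2 : ℝ) ^ 4 * ((G.det : ℚ) : ℝ) := by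
    have h1 : (M₀ * M₀.transpose).det = M₀.det ^ 2 := by rw [Matrix.det_mul, Matrix.det_transpose, sq]
    rw [← h1, hgram, Matrix.det_smul, Fintype.card_fin]
    congr 1
    rw [show (G.map ((↑) : ℚ → ℝ)) = (Rat.castHom ℝ).mapMatrix G from rfl, ← RingHom.map_det]; rfl
  rw [covol_eq_abs_det ψ hψs hL bL, ← hM₀, sq_abs, hdet]
  ring

end Translates

end Literature.NumberTheory.Automorphic
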